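import Summits.HodgeConjecture.HodgeConjecture.Theorems.Ring2WeilCoverageTypeRelativeNormSign
import HarnessLib

/-!
# Weil-type family coverage — THE RELATIVE NORM-SIGN OBSTRUCTION AT THE INDEX-2 LEVELS `39` AND `56`: a real generator
# `ϖ₀` whose relative norm to `ℚ(√13)` resp. `ℚ(√2)` is NEGATIVE at some real place never gives a type `(ϖ₀)𝔣₀` next
# to an occurring type `𝔣₀` — on ANY lattice `𝔪`, for ANY CM type `Φ`

research route conditional on HC_CM; not a corollary; Q11.4-sentence-2 already refuted in dim ≥ 3.

Ring 2, WEIL-TYPE FAMILY-COVERAGE CENSUS (`HOME/WEIL-FAMILY-COVERAGE.md` `## b01`, blocks b01.25 (A), b01.39–40, b01.42; owner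
ring2-b01), part 58b of the `Ring2WeilCoverage*` series: part 58's relative engine (`…TypeRelativeNormSign`:
`not_and_of_re_relNorm_neg` under the RELATIVE THEOREM L (i) «`Re σ(N_{K⁺/ℚ(s)}(v)) > 0` for every unit `v` of `𝓞 K⁺`
and every `σ`») at the two census levels where that input is a tree theorem — parts 32/34b
(`re_embedding_relNorm_pos_thirteen` for `K⁺ ∋ s = √13`, `w`, `w² = 78 − 18s`; `re_embedding_relNorm_pos_two` for
`K⁺ ∋ s = √2`, `w = √7`), with the elements of parts 36/37 (`s = 1 + 2(η + η³ + η⁴ + η⁹ + η¹⁰ + η¹²)`, `η = ζ₃₉³`;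
`s = μ + μ⁷`, `μ = ζ₅₆⁷`):

* (part 58 §5: `relNorm_units_pos_thirtyNine` / `relNorm_units_pos_fiftySix` — the relative THEOREM L (i) packaged for
  the displayed `s ∈ K⁺`.)
* **`not_and_thirtyNine_of_re_relNorm_neg` / `not_and_fiftySix_of_re_relNorm_neg`** — for ANY lattice `𝔪`, type `𝔣₀`,
  skew `ζ₀` of type `𝔣₀`, CM type `Φ` and `ϖ₀ ∈ 𝓞 K⁺`: if `Re φ₀(N_{K⁺/ℚ(s)}(ϖ₀)) < 0` for some `φ₀`, the types `𝔣₀` and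
  `(ϖ₀)𝔣₀` do not both occur on `ℂ^Φ/D(𝔪)`;
* **`not_exists_span_thirtyNine_of_principal_of_re_relNorm_neg` / `…fiftySix…`** — in particular a principally
  polarised `ℂ^Φ/D(𝔪)` (`ι`-compatibly; e.g. `ℂ^Φ/Φ(ℤ[ζ₃₉])` with `n₊₋(Φ)` odd, part 41, or `ℂ^Φ/Φ(𝔔)` with `n₊₋(Φ)`
  even, part 45) carries NO `Φ`-positive divisor of type `(ϖ₀)` for such `ϖ₀`.

So at `39/56` the flip is governed place by place: b01.41 (B)'s remark «no ramified prime flips at `39/56`» and b01.40's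
lattice-class flip are the cases `N_{K⁺/ℚ(s)}(ϖ₀) ≫ 0` resp. `α ≫ 0`; a generator with a relative norm of mixed sign
flips exactly one of the two twisted parities.  The existence half (two-class unit supply, parts 39/40) is not
assembled here.  HONEST FRAMING: torus-level statements about Shimura's divisors of type `(K; Φ; 𝔣₀)` [Sh98 §14.3 Prop.
5]; nothing here is a statement about Hodge classes, `W_K`, general members or HC; `HC_CM` is used nowhere.  No `def`,
no named fact, no `sorry`.

References: [cite: Shimura1998, §14.3 Prop. 4–5, pp. 103–104]; census b01.25 (A) / b01.39–40 (seat-derived).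
-/

noncomputable section

open scoped Classical nonZeroDivisors NumberField ComplexConjugate
open NumberField NumberField.ComplexEmbedding Module FractionalIdeal Complex Polynomial Finset IntermediateField

namespace Summit.HodgeConjecture.Ring2WeilCoverage.TypeRelativeNormSignLevels

open Literature.AlgebraicGeometry.Motives (CMType)
open Literature.NumberTheory.ComplexMultiplication
open Literature.NumberTheory.ComplexMultiplication.CMTypeLattice
open Summit.HodgeConjecture.Ring2WeilCoverage.TypeNormSign
open Summit.HodgeConjecture.Ring2WeilCoverage.TypeRelativeNormSign
open Summit.HodgeConjecture.Ring2WeilCoverage.CyclotomicDifferent (xi_ne_zero isOfType_one_xi_top)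
open Summit.HodgeConjecture.Ring2WeilCoverage.CyclotomicPrincipalObstruction (complexConj_xi)

variable {K : Type} [Field K] [NumberField K] [IsCMField K] {ζ : K}

/-- `Re φ₀|_{K⁺}(N_{K⁺/ℚ(s)}(x))` — the relative norm of `x ∈ K⁺` to `ℚ(s)` read at the place under `φ₀`. -/
local notation3 (prettyPrint := false) "RN[" φ₀ "," s "] " x:max =>
  (((RingHom.comp (φ₀ : K →+* ℂ) (algebraMap (maximalRealSubfield K) K))
    (algebraMap (ℚ⟮(s : maximalRealSubfield K)⟯) (maximalRealSubfield K)
      (Algebra.norm (ℚ⟮(s : maximalRealSubfield K)⟯) (x : maximalRealSubfield K)))).re)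

/-! ### Level `39`: `s = √13 = 1 + 2(ζ³ + ζ⁹ + ζ¹² + ζ²⁷ + ζ³⁰ + ζ³⁶)` -/

section Level39


/-- **THE RELATIVE OBSTRUCTION AT `39`**: for ANY lattice `𝔪`, type `𝔣₀`, skew `ζ₀ ≠ 0` of type `𝔣₀`, CM type `Φ` and
`ϖ₀ ∈ 𝓞 K⁺`: if the relative norm `N_{K⁺/ℚ(√13)}(ϖ₀)` is NEGATIVE at the place under some `φ₀`, the types `𝔣₀` and
`(ϖ₀)𝔣₀` do not BOTH occur on `ℂ^Φ/D(𝔪)` (part 58 `not_and_of_re_relNorm_neg` + `relNorm_units_pos_thirtyNine`).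
research route conditional on HC_CM; not a corollary; Q11.4-sentence-2 already refuted in dim ≥ 3. [cite: Shimura1998, §14.3 Prop. 5, p. 104] -/
theorem not_and_thirtyNine_of_re_relNorm_neg (hζ : IsPrimitiveRoot ζ 39) (Φ : CMType K)
    (𝔪 : (FractionalIdeal (𝓞 K)⁰ K)ˣ) {ζ₀ : K} {𝔣₀ : Ideal (𝓞 (maximalRealSubfield K))}
    (hζ₀ : IsCMField.complexConj K ζ₀ = -ζ₀) (h0 : ζ₀ ≠ 0) (hT : IsOfType 𝔪 ζ₀ 𝔣₀) (s : maximalRealSubfield K)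
    (hs : (s : K) = 1 + 2 * (ζ ^ 3 + ζ ^ 9 + ζ ^ 12 + ζ ^ 27 + ζ ^ 30 + ζ ^ 36))
    {ϖ₀ : 𝓞 (maximalRealSubfield K)} (φ₀ : K →+* ℂ) (hneg : RN[φ₀, s] ϖ₀ < 0) :
    ¬ ((∃ ζ' : K, IsCMField.complexConj K ζ' = -ζ' ∧ (∀ φ : Φ.1, 0 < (φ.1 ζ').im) ∧ IsOfType 𝔪 ζ' 𝔣₀) ∧
        (∃ ζ' : K, IsCMField.complexConj K ζ' = -ζ' ∧ (∀ φ : Φ.1, 0 < (φ.1 ζ').im) ∧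
          IsOfType 𝔪 ζ' (Ideal.span {ϖ₀} * 𝔣₀))) :=
  not_and_of_re_relNorm_neg Φ 𝔪 hζ₀ h0 hT s φ₀ hneg (relNorm_units_pos_thirtyNine hζ s hs)

/-- **A principally polarised `ℂ^Φ/D(𝔪)` at `39` carries no type `(ϖ₀)` with `N_{K⁺/ℚ(√13)}(ϖ₀)` negative at some
place** (any lattice `𝔪` with a skew `ζ₀` of principal type on it, any `Φ`).
research route conditional on HC_CM; not a corollary; Q11.4-sentence-2 already refuted in dim ≥ 3. [cite: Shimura1998, §14.3 Prop. 5, p. 104] -/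
theorem not_exists_span_thirtyNine_of_principal_of_re_relNorm_neg (hζ : IsPrimitiveRoot ζ 39) (Φ : CMType K)
    (𝔪 : (FractionalIdeal (𝓞 K)⁰ K)ˣ) {ζ₀ : K} (hζ₀ : IsCMField.complexConj K ζ₀ = -ζ₀) (h0 : ζ₀ ≠ 0)
    (hT : IsOfType 𝔪 ζ₀ ⊤) (s : maximalRealSubfield K)
    (hs : (s : K) = 1 + 2 * (ζ ^ 3 + ζ ^ 9 + ζ ^ 12 + ζ ^ 27 + ζ ^ 30 + ζ ^ 36))
    {ϖ₀ : 𝓞 (maximalRealSubfield K)} (φ₀ : K →+* ℂ) (hneg : RN[φ₀, s] ϖ₀ < 0)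
    (hpr : ∃ ζ' : K, IsCMField.complexConj K ζ' = -ζ' ∧ (∀ φ : Φ.1, 0 < (φ.1 ζ').im) ∧ IsOfType 𝔪 ζ' ⊤) :
    ¬ ∃ ζ' : K, IsCMField.complexConj K ζ' = -ζ' ∧ (∀ φ : Φ.1, 0 < (φ.1 ζ').im) ∧
        IsOfType 𝔪 ζ' (Ideal.span {ϖ₀}) :=
  not_exists_span_of_principal_of_re_relNorm_neg Φ 𝔪 hζ₀ h0 hT s φ₀ hneg (relNorm_units_pos_thirtyNine hζ s hs) hpr

/-- **On the principal torus `ℂ^Φ/Φ(ℤ[ζ₃₉])`** (`𝔪 = 1`, reference `ξ = ζ¹¹/Φ₃₉′(ζ)`): if it is principally polarisable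
(`ι`-compatibly; by part 41 iff both twisted counts are even) then it carries NO `Φ`-positive divisor of type `(ϖ₀)`
whenever `N_{K⁺/ℚ(√13)}(ϖ₀)` is negative at some place.
research route conditional on HC_CM; not a corollary; Q11.4-sentence-2 already refuted in dim ≥ 3. [cite: Shimura1998, §14.3 Prop. 5, p. 104] -/
theorem not_exists_span_one_thirtyNine_of_principal_of_re_relNorm_neg [IsCyclotomicExtension {39} ℚ K]
    (hζ : IsPrimitiveRoot ζ 39) (Φ : CMType K) (s : maximalRealSubfield K)
    (hs : (s : K) = 1 + 2 * (ζ ^ 3 + ζ ^ 9 + ζ ^ 12 + ζ ^ 27 + ζ ^ 30 + ζ ^ 36))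
    {ϖ₀ : 𝓞 (maximalRealSubfield K)} (φ₀ : K →+* ℂ) (hneg : RN[φ₀, s] ϖ₀ < 0)
    (hpr : ∃ ζ' : K, IsCMField.complexConj K ζ' = -ζ' ∧ (∀ φ : Φ.1, 0 < (φ.1 ζ').im) ∧
      IsOfType (1 : (FractionalIdeal (𝓞 K)⁰ K)ˣ) ζ' ⊤) :
    ¬ ∃ ζ' : K, IsCMField.complexConj K ζ' = -ζ' ∧ (∀ φ : Φ.1, 0 < (φ.1 ζ').im) ∧
        IsOfType (1 : (FractionalIdeal (𝓞 K)⁰ K)ˣ) ζ' (Ideal.span {ϖ₀}) := by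
  have hg : Nat.totient 39 = 2 * (11 + 1) := by decide
  exact not_exists_span_thirtyNine_of_principal_of_re_relNorm_neg hζ Φ 1 (complexConj_xi hζ hg) (xi_ne_zero hζ 11)
    (isOfType_one_xi_top hζ 11) s hs φ₀ hneg hpr

end Level39

/-! ### Level `56`: `s = √2 = ζ⁷ + ζ⁴⁹` -/

section Level56


/-- **THE RELATIVE OBSTRUCTION AT `56`**: for ANY lattice `𝔪`, type `𝔣₀`, skew `ζ₀ ≠ 0` of type `𝔣₀`, CM type `Φ` and
`ϖ₀ ∈ 𝓞 K⁺`: if `N_{K⁺/ℚ(√2)}(ϖ₀)` is NEGATIVE at the place under some `φ₀`, the types `𝔣₀` and `(ϖ₀)𝔣₀` do not BOTH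
occur on `ℂ^Φ/D(𝔪)`.
research route conditional on HC_CM; not a corollary; Q11.4-sentence-2 already refuted in dim ≥ 3. [cite: Shimura1998, §14.3 Prop. 5, p. 104] -/
theorem not_and_fiftySix_of_re_relNorm_neg (hζ : IsPrimitiveRoot ζ 56) (Φ : CMType K)
    (𝔪 : (FractionalIdeal (𝓞 K)⁰ K)ˣ) {ζ₀ : K} {𝔣₀ : Ideal (𝓞 (maximalRealSubfield K))}
    (hζ₀ : IsCMField.complexConj K ζ₀ = -ζ₀) (h0 : ζ₀ ≠ 0) (hT : IsOfType 𝔪 ζ₀ 𝔣₀) (s : maximalRealSubfield K)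
    (hs : (s : K) = ζ ^ 7 + ζ ^ 49)
    {ϖ₀ : 𝓞 (maximalRealSubfield K)} (φ₀ : K →+* ℂ) (hneg : RN[φ₀, s] ϖ₀ < 0) :
    ¬ ((∃ ζ' : K, IsCMField.complexConj K ζ' = -ζ' ∧ (∀ φ : Φ.1, 0 < (φ.1 ζ').im) ∧ IsOfType 𝔪 ζ' 𝔣₀) ∧
        (∃ ζ' : K, IsCMField.complexConj K ζ' = -ζ' ∧ (∀ φ : Φ.1, 0 < (φ.1 ζ').im) ∧
          IsOfType 𝔪 ζ' (Ideal.span {ϖ₀} * 𝔣₀))) :=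
  not_and_of_re_relNorm_neg Φ 𝔪 hζ₀ h0 hT s φ₀ hneg (relNorm_units_pos_fiftySix hζ s hs)

/-- **A principally polarised `ℂ^Φ/D(𝔪)` at `56` carries no type `(ϖ₀)` with `N_{K⁺/ℚ(√2)}(ϖ₀)` negative at some
place** (any lattice `𝔪` with a skew `ζ₀` of principal type on it, any `Φ`).
research route conditional on HC_CM; not a corollary; Q11.4-sentence-2 already refuted in dim ≥ 3. [cite: Shimura1998, §14.3 Prop. 5, p. 104] -/
theorem not_exists_span_fiftySix_of_principal_of_re_relNorm_neg (hζ : IsPrimitiveRoot ζ 56) (Φ : CMType K)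
    (𝔪 : (FractionalIdeal (𝓞 K)⁰ K)ˣ) {ζ₀ : K} (hζ₀ : IsCMField.complexConj K ζ₀ = -ζ₀) (h0 : ζ₀ ≠ 0)
    (hT : IsOfType 𝔪 ζ₀ ⊤) (s : maximalRealSubfield K) (hs : (s : K) = ζ ^ 7 + ζ ^ 49)
    {ϖ₀ : 𝓞 (maximalRealSubfield K)} (φ₀ : K →+* ℂ) (hneg : RN[φ₀, s] ϖ₀ < 0)
    (hpr : ∃ ζ' : K, IsCMField.complexConj K ζ' = -ζ' ∧ (∀ φ : Φ.1, 0 < (φ.1 ζ').im) ∧ IsOfType 𝔪 ζ' ⊤) :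
    ¬ ∃ ζ' : K, IsCMField.complexConj K ζ' = -ζ' ∧ (∀ φ : Φ.1, 0 < (φ.1 ζ').im) ∧
        IsOfType 𝔪 ζ' (Ideal.span {ϖ₀}) :=
  not_exists_span_of_principal_of_re_relNorm_neg Φ 𝔪 hζ₀ h0 hT s φ₀ hneg (relNorm_units_pos_fiftySix hζ s hs) hpr

/-- **On the principal torus `ℂ^Φ/Φ(ℤ[ζ₅₆])`** (`𝔪 = 1`, reference `ξ = ζ¹¹/Φ₅₆′(ζ)`): if it is principally polarisable
then it carries NO `Φ`-positive divisor of type `(ϖ₀)` whenever `N_{K⁺/ℚ(√2)}(ϖ₀)` is negative at some place.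
research route conditional on HC_CM; not a corollary; Q11.4-sentence-2 already refuted in dim ≥ 3. [cite: Shimura1998, §14.3 Prop. 5, p. 104] -/
theorem not_exists_span_one_fiftySix_of_principal_of_re_relNorm_neg [IsCyclotomicExtension {56} ℚ K]
    (hζ : IsPrimitiveRoot ζ 56) (Φ : CMType K) (s : maximalRealSubfield K) (hs : (s : K) = ζ ^ 7 + ζ ^ 49)
    {ϖ₀ : 𝓞 (maximalRealSubfield K)} (φ₀ : K →+* ℂ) (hneg : RN[φ₀, s] ϖ₀ < 0)
    (hpr : ∃ ζ' : K, IsCMField.complexConj K ζ' = -ζ' ∧ (∀ φ : Φ.1, 0 < (φ.1 ζ').im) ∧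
      IsOfType (1 : (FractionalIdeal (𝓞 K)⁰ K)ˣ) ζ' ⊤) :
    ¬ ∃ ζ' : K, IsCMField.complexConj K ζ' = -ζ' ∧ (∀ φ : Φ.1, 0 < (φ.1 ζ').im) ∧
        IsOfType (1 : (FractionalIdeal (𝓞 K)⁰ K)ˣ) ζ' (Ideal.span {ϖ₀}) := by
  have hg : Nat.totient 56 = 2 * (11 + 1) := by decide
  exact not_exists_span_fiftySix_of_principal_of_re_relNorm_neg hζ Φ 1 (complexConj_xi hζ hg) (xi_ne_zero hζ 11)
    (isOfType_one_xi_top hζ 11) s hs φ₀ hneg hpr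

end Level56

end Summit.HodgeConjecture.Ring2WeilCoverage.TypeRelativeNormSignLevels

end
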